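import Mathlib
import Literature.Computability.Complexity.SymmetricCircuit
import Literature.Computability.Complexity.CircuitComposition
import Literature.Computability.Complexity.NegationElimination
import Literature.Computability.Complexity.CircuitRestriction
import Literature.Computability.Complexity.BlockTuples
import Summits.PneNP.PneNP.Theorems.SymmetryBudgetWindowBarrierStubHeaderHardwiring
import Summits.PneNP.PneNP.Theorems.SymmetryBudgetWindowBarrierMaterialiseLayout

/-!
# Materialisation of monadic guesses (generic input sort) — symmetry of the layout
(helper for crux `SymmetryBudget.WindowBarrier`, item stmt-PneNP-2145, stub S4 / core (★); part 2 of
`SymmetryBudgetWindowBarrierMaterialiseLayout.lean`, whose module docstring states the result)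

Here: the commutation identity `relabel_shift_comm` and `layout_isInducedAut` — for `σ ∈ Sym(Fin g)`
acting on the input sort `ι` by `act σ`, a permutation `π` of the blocks compatible with `σ` on the
subsets and an automorphism `τ_C` of the template over `Sum.map (act σ) σ`, the block permutation
`id₂ ⊕ (π ≀ τ_C) ⊕ id₁` is an automorphism of the layout over `act σ` (block outputs of the final gate
permuted by `π ⊕ id_A`, `Materialise.exists_extendBy`). Folklore.
-/

-- `Summit.PneNP.PneNP.…` duplicates `PneNP` BY DESIGN (single-problem summit).
set_option linter.dupNamespace false

namespace Summit.PneNP.PneNP.Theorems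

open Literature.Computability.Complexity Literature.Computability.Complexity.GateList
open scoped Classical

namespace Materialise
/-! ### Symmetry: the block permutation is an automorphism of the layout -/

section Symm

variable {ι : Type*} {g N A : ℕ} {C : Circuit (ι ⊕ Fin g)} {pre : List (Gate ι)}
  {φ : Fin N → (ι ⊕ Fin g) → ι ⊕ ℕ} {D : Circuit ι}
  {op : (Fin (N + A) → Bool) → Bool} {κ : ℕ → ℕ}
  {e : Fin N → Finset (Fin g)} {act : Equiv.Perm (Fin g) → ι → ι}

/-- **The commutation identity.** Relabelling by `(σ × σ, τ)` after shifting into block `i`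
equals shifting into block `π i` after relabelling by `((σ × σ) ⊕ σ, τ_C)` inside the template, on
every wire of the template — provided `σ` carries the subset of block `i` onto that of block `π i`. -/
theorem relabel_shift_comm {M : ℕ} (σ : Equiv.Perm (Fin g)) (τC : Equiv.Perm (Fin C.gates.length))
    (π : Equiv.Perm (Fin N)) (τ : Equiv.Perm (Fin M))
    (hτ : ∀ v : ℕ, Circuit.relabelGate τ v =
      if v < 2 then v else if v < 2 + N * C.gates.length then
        2 + Circuit.relabelGate π ((v - 2) / C.gates.length) * C.gates.length +
          Circuit.relabelGate τC ((v - 2) % C.gates.length) else v)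
    (hφ_inl : ∀ i p, φ i (Sum.inl p) = Sum.inl p)
    (hφ_inr : ∀ i u, φ i (Sum.inr u) = Sum.inr (if u ∈ e i then 0 else 1))
    (hπ : ∀ (i : Fin N) (u : Fin g), σ u ∈ e (π i) ↔ u ∈ e i)
    (i : Fin N) (w : (ι ⊕ Fin g) ⊕ ℕ) (hw : ∀ k, w = Sum.inr k → k < C.gates.length) :
    Circuit.relabelWire (act σ) τ
        (shiftWire (φ i) (2 + (i : ℕ) * C.gates.length) w) =
      shiftWire (φ (π i)) (2 + (π i : ℕ) * C.gates.length)
        (Circuit.relabelWire (Sum.map (act σ) σ) τC w) := by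
  cases w with
  | inl w' =>
    cases w' with
    | inl p =>
      simp only [shiftWire, Circuit.relabelWire_inl, Sum.map_inl, hφ_inl]
    | inr u =>
      simp only [shiftWire, Circuit.relabelWire_inl, Sum.map_inr, hφ_inr, Circuit.relabelWire_inr,
        Sum.inr.injEq]
      rw [hτ]
      have hb : (if u ∈ e i then 0 else 1) < 2 := by split_ifs <;> omega
      rw [if_pos hb]
      by_cases hu : u ∈ e i
      · rw [if_pos hu, if_pos ((hπ i u).2 hu)]
      · rw [if_neg hu, if_neg (fun h => hu ((hπ i u).1 h))]
  | inr k =>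
    have hk := hw k rfl
    simp only [shiftWire, Circuit.relabelWire_inr, Sum.inr.injEq]
    rw [hτ]
    have hik := blockIndex_lt hk i.2
    have h1 : ¬ k + (2 + (i : ℕ) * C.gates.length) < 2 := by omega
    have h2 : k + (2 + (i : ℕ) * C.gates.length) < 2 + N * C.gates.length := by omega
    rw [if_neg h1, if_pos h2]
    have e1 : k + (2 + (i : ℕ) * C.gates.length) - 2 = (i : ℕ) * C.gates.length + k := by omega
    have hdm := div_mod_block (k := (i : ℕ)) hk
    rw [e1, hdm.1, hdm.2, Circuit.relabelGate_of_lt π i.2, Circuit.relabelGate_of_lt τC hk, Fin.eta]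
    omega

/-- The permutation `π ⊕ id_A` of `Fin (N + A)`. -/
theorem exists_extendBy {N : ℕ} (π : Equiv.Perm (Fin N)) (A : ℕ) :
    ∃ π' : Equiv.Perm (Fin (N + A)), ∀ v : ℕ,
      Circuit.relabelGate π' v = if v < N then Circuit.relabelGate π v else v := by
  have hlt : ∀ (θ : Equiv.Perm (Fin N)) (v : ℕ), v < N + A →
      (if v < N then Circuit.relabelGate θ v else v) < N + A := by
    intro θ v hv
    split_ifs with h
    · exact (Circuit.relabelGate_lt θ h).trans_le (Nat.le_add_right N A)
    · exact hv
  have hinv : ∀ (θ : Equiv.Perm (Fin N)) (v : ℕ),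
      (if (if v < N then Circuit.relabelGate θ v else v) < N then
        Circuit.relabelGate θ.symm (if v < N then Circuit.relabelGate θ v else v)
        else (if v < N then Circuit.relabelGate θ v else v)) = v := by
    intro θ v
    by_cases h : v < N
    · rw [if_pos h, if_pos (Circuit.relabelGate_lt θ h), Circuit.relabelGate_of_lt θ h,
        Circuit.relabelGate_of_lt θ.symm (θ ⟨v, h⟩).2, Fin.eta, Equiv.symm_apply_apply]
    · rw [if_neg h, if_neg h]
  refine ⟨⟨fun v => ⟨_, hlt π v v.2⟩, fun v => ⟨_, hlt π.symm v v.2⟩,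
    fun v => Fin.ext (hinv π v),
    fun v => Fin.ext (by simpa only [Equiv.symm_symm] using hinv π.symm v)⟩, fun v => ?_⟩
  by_cases hv : v < N + A
  · rw [Circuit.relabelGate_of_lt _ hv]
    rfl
  · have h1 : ¬ v < N := by omega
    rw [Circuit.relabelGate_of_le _ (not_lt.1 hv), if_neg h1]

/-- **The block permutation is an automorphism of the layout.** For `σ ∈ Sym(Fin g)`, a
permutation `π` of the blocks compatible with `σ` on the subsets (`σ u ∈ e (π i) ↔ u ∈ e i`) and
an automorphism `τ_C` of the template over `(σ × σ) ⊕ σ`, the permutation `id₂ ⊕ (π ≀ τ_C) ⊕ id₁`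
of the gates of the layout is an automorphism over `σ × σ`. -/
theorem layout_isInducedAut
    (hDg : D.gates = pre ++
      (List.ofFn fun v : Fin (N * C.gates.length) =>
        reloc (φ ⟨v / C.gates.length, div_lt_of_lt_mul v.2⟩) (2 + (v / C.gates.length) * C.gates.length)
          (C.gates[(v : ℕ) % C.gates.length]'(mod_lt_of_lt_mul v.2))) ++
      [⟨N + A, op, fun k => if h : (k : ℕ) < N then
          shiftWire (φ ⟨k, h⟩) (2 + (k : ℕ) * C.gates.length) C.output
        else Sum.inr (κ (k - N))⟩])
    (hDo : D.output = Sum.inr (2 + N * C.gates.length)) (hpreL : pre.length = 2)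
    (hpre0 : ∀ q ∈ pre, q.arity = 0) (hκ : ∀ i, κ i < 2)
    (hφ_inl : ∀ i p, φ i (Sum.inl p) = Sum.inl p)
    (hφ_inr : ∀ i u, φ i (Sum.inr u) = Sum.inr (if u ∈ e i then 0 else 1))
    (σ : Equiv.Perm (Fin g)) (π : Equiv.Perm (Fin N))
    (hπ : ∀ (i : Fin N) (u : Fin g), σ u ∈ e (π i) ↔ u ∈ e i)
    (τC : Equiv.Perm (Fin C.gates.length))
    (hτC : C.IsInducedAut (Sum.map (act σ) σ) τC) :
    ∃ τ : Equiv.Perm (Fin D.gates.length),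
      D.IsInducedAut (act σ) τ := by
  have hlen := layout_length hDg hpreL
  obtain ⟨τ, hτ⟩ : ∃ τ : Equiv.Perm (Fin D.gates.length), ∀ v : ℕ, Circuit.relabelGate τ v =
      if v < 2 then v else if v < 2 + N * C.gates.length then
        2 + Circuit.relabelGate π ((v - 2) / C.gates.length) * C.gates.length +
          Circuit.relabelGate τC ((v - 2) % C.gates.length) else v := by
    rw [hlen]
    exact exists_blockPerm N C.gates.length π τC
  have hcomm := relabel_shift_comm (act := act) σ τC π τ hτ hφ_inl hφ_inr hπ
  have hwC : ∀ k, C.output = Sum.inr k → k < C.gates.length := fun k hk => C.wf_output k hk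
  refine ⟨τ, ?_, ?_⟩
  · -- the output gate is fixed
    rw [hDo, Circuit.relabelWire_inr, hτ]
    have h1 : ¬ 2 + N * C.gates.length < 2 := by omega
    rw [if_neg h1, if_neg (lt_irrefl _)]
  · rintro ⟨J, hJ⟩
    have hJ' : J < 2 + N * C.gates.length + 1 := by rw [← hlen]; exact hJ
    have hv : ((τ ⟨J, hJ⟩ : Fin D.gates.length) : ℕ) = Circuit.relabelGate τ J :=
      (Circuit.relabelGate_of_lt τ hJ).symm
    simp only [Fin.getElem_fin]
    by_cases hJ1 : J < 2
    · -- prefix gates: fixed, no arguments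
      have hvJ : ((τ ⟨J, hJ⟩ : Fin D.gates.length) : ℕ) = J := by rw [hv, hτ, if_pos hJ1]
      rw [getElem_congr_idx hvJ]
      refine ⟨rfl, ?_⟩
      have h0 : (D.gates[J]).arity = 0 := by
        rw [layout_getElem_pre hDg hpreL hJ1 hJ]
        exact hpre0 _ (List.getElem_mem _)
      rw [List.ofFn_eq_nil_iff.2 h0, List.map_nil]
    · by_cases hJ2 : J < 2 + N * C.gates.length
      · -- block gates
        have hvv : J - 2 < N * C.gates.length := by omega
        have hi : (J - 2) / C.gates.length < N := div_lt_of_lt_mul hvv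
        have hj : (J - 2) % C.gates.length < C.gates.length := mod_lt_of_lt_mul hvv
        have hJe : J = 2 + (J - 2) / C.gates.length * C.gates.length + (J - 2) % C.gates.length := by
          have := Nat.div_add_mod' (J - 2) C.gates.length
          omega
        have hvJ : ((τ ⟨J, hJ⟩ : Fin D.gates.length) : ℕ) =
            2 + (π ⟨_, hi⟩ : ℕ) * C.gates.length + (τC ⟨_, hj⟩ : ℕ) := by
          rw [hv, hτ, if_neg hJ1, if_pos hJ2, Circuit.relabelGate_of_lt π hi,
            Circuit.relabelGate_of_lt τC hj]
        have hget1 := layout_getElem_block hDg hpreL ⟨_, hi⟩ ⟨_, hj⟩ (by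
          show 2 + (J - 2) / C.gates.length * C.gates.length + (J - 2) % C.gates.length < D.gates.length
          rw [← hJe]; exact hJ)
        have hget2 := layout_getElem_block hDg hpreL (π ⟨_, hi⟩) (τC ⟨_, hj⟩)
          (by rw [hlen]; have := blockIndex_lt (τC ⟨_, hj⟩).2 (π ⟨_, hi⟩).2; omega)
        rw [getElem_congr_idx hvJ, hget2, getElem_congr_idx hJe, hget1]
        obtain ⟨hfn, hperm⟩ := hτC.2 ⟨_, hj⟩
        simp only [Fin.getElem_fin] at hfn hperm
        refine ⟨by rw [reloc_fn, reloc_fn]; exact hfn, ?_⟩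
        rw [HeaderHardwiring.ofFn_reloc_args, HeaderHardwiring.ofFn_reloc_args]
        have hmm : ((List.ofFn (C.gates[(J - 2) % C.gates.length]).args).map
              (Circuit.relabelWire (Sum.map (act σ) σ) τC)).map
              (shiftWire (φ (π ⟨_, hi⟩)) (2 + (π ⟨_, hi⟩ : ℕ) * C.gates.length)) =
            ((List.ofFn (C.gates[(J - 2) % C.gates.length]).args).map
              (shiftWire (φ ⟨_, hi⟩) (2 + (J - 2) / C.gates.length * C.gates.length))).map
              (Circuit.relabelWire (act σ) τ) := by
          rw [List.map_map, List.map_map]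
          refine List.map_congr_left fun w hw => ?_
          obtain ⟨a, rfl⟩ := List.mem_ofFn.1 hw
          exact (hcomm ⟨_, hi⟩ _ fun k hk => (C.wf _ hj a k hk).trans hj).symm
        rw [← hmm]
        exact hperm.map _
      · -- the final gate: fixed, block arguments permuted by `π`, constants fixed
        have hJe : J = 2 + N * C.gates.length := by omega
        subst hJe
        have hvJ : ((τ ⟨2 + N * C.gates.length, hJ⟩ : Fin D.gates.length) : ℕ) =
            2 + N * C.gates.length := by
          rw [hv, hτ, if_neg hJ1, if_neg (lt_irrefl _)]
        rw [getElem_congr_idx hvJ]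
        refine ⟨rfl, ?_⟩
        rw [layout_getElem_final hDg hpreL hJ]
        dsimp only
        obtain ⟨π', hπ'⟩ := exists_extendBy π A
        rw [List.map_ofFn]
        have hfun : (Circuit.relabelWire (act σ) τ ∘
            fun k : Fin (N + A) => if h : (k : ℕ) < N then
              shiftWire (φ ⟨k, h⟩) (2 + (k : ℕ) * C.gates.length) C.output
              else Sum.inr (κ (k - N))) =
            (fun k : Fin (N + A) => if h : (k : ℕ) < N then
              shiftWire (φ ⟨k, h⟩) (2 + (k : ℕ) * C.gates.length) C.output
              else Sum.inr (κ (k - N))) ∘ π' := by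
          funext k
          simp only [Function.comp_apply]
          have hk' : ((π' k : Fin (N + A)) : ℕ) = Circuit.relabelGate π' k :=
            (Circuit.relabelGate_of_lt π' k.2).symm
          by_cases hk : (k : ℕ) < N
          · have hπk : ((π' k : Fin (N + A)) : ℕ) = (π ⟨k, hk⟩ : ℕ) := by
              rw [hk', hπ', if_pos hk, Circuit.relabelGate_of_lt π hk]
            have hπk' : ((π' k : Fin (N + A)) : ℕ) < N := by rw [hπk]; exact (π ⟨k, hk⟩).2
            rw [dif_pos hk, dif_pos hπk', hcomm ⟨k, hk⟩ C.output hwC, hτC.1]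
            congr 2
            · exact Fin.ext hπk.symm
            · rw [hπk]
          · have hπk : ((π' k : Fin (N + A)) : ℕ) = k := by rw [hk', hπ', if_neg hk]
            have hπk' : ¬ ((π' k : Fin (N + A)) : ℕ) < N := by rw [hπk]; exact hk
            rw [dif_neg hk, dif_neg hπk', Circuit.relabelWire_inr, hτ, if_pos (hκ _), hπk]
        rw [hfun]
        exact (Equiv.Perm.ofFn_comp_perm π' _).symm

end Symm

end Materialise

/-- **Registered sub-goal `stub_monadicExtendBy`** (crux stmt-PneNP-2145, helper of S4): the
permutation `π ⊕ id_A` (`Materialise.exists_extendBy`). -/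
theorem stub_monadicExtendBy : ∀ (N A : ℕ) (π : Equiv.Perm (Fin N)), ∃ π' : Equiv.Perm (Fin (N + A)), ∀ v : ℕ, Circuit.relabelGate π' v = if v < N then Circuit.relabelGate π v else v :=
  fun _ A π => Materialise.exists_extendBy π A

end Summit.PneNP.PneNP.Theorems
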